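import Literature.IUT.LogThetaLattice.LocalLogShells
import HarnessLib

/-!
# [IUTchIII] Rmk 1.2.2 (i), (b^non): the predicate `IntegersSubsetLogShell O logk p` (FACT-LIST F-2612) is a SCHEMA —
# its universal closure is refutable; the instance at the `p`-adic logarithm is the proved theorem

S. Mochizuki, *Inter-universal Teichmüller Theory III*, kurims manuscript (May 2020), §1, Remark 1.2.2 (i)
p. 36 [Mochizuki2012, III Rmk 1.2.2 (i) p.36] (D-0012 claim key; the item is a classical local-field fact the
text recalls): "`O_k^▷ := O_k \ {0} ⊆ O_k ⊆ I_k`" with `I_k := (p_v^*)⁻¹ · log_k(O_k^×)`, `log_k` the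
`p_v`-adic logarithm of the MLF `k = K_v`.

Negative knowledge recorded next to `LocalLogShells.lean` (abc-iut-L6-t3; FACT-LIST row **F-2612**, class
`IUTch`, status `conditional`), PROOF-ONLY (no definitions, no instances), abc-iut cell seat abc-iut-w5-d182.

The typed predicate `IntegersSubsetLogShell O logk p` quantifies over an ARBITRARY field `k`, an ARBITRARY
valuation subring `O ⊆ k`, an ARBITRARY additive homomorphism `logk : O^× → (k, +)` and an ARBITRARY natural
number `p`; nothing ties `logk` to the `p`-adic logarithm or `p` to the residue characteristic.  Its universal
closure is therefore false, already at the zero homomorphism: the log-shell of `logk = 0` is `{0}`, which does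
not contain `1 ∈ O`.  This file supplies the kernel objects

* `nonarchLogShell_zero` — `I_k = {0}` for `logk = 0`;
* `not_integersSubsetLogShell_zero` — `¬ IntegersSubsetLogShell O 0 p` for EVERY `k`, `O`, `p`;
* `exists_not_integersSubsetLogShell` — hence at every `(k, O, p)` some `logk` violates the predicate;
* `not_forall_integersSubsetLogShell` — the fully quantified closure is false (witness `k = ℚ`, `O = ⊤`, `p = 2`).

The INSTANCE FORM at the genuine logarithm — the statement the text prints — is PROVED in tree:
`Literature.IUT.LogThetaLattice.integersSubsetLogShell_of_eq_unitLog` (`LocalLogShellsProofs.lean`,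
abc-iut-L6-t21), for a complete nonarchimedean `K` of residue characteristic `p`, `O = {‖x‖ ≤ 1}` and any `logk`
agreeing with `unitLog = log_p` on `O^×`.  So F-2612 is admissible ONLY in that instance form (FACT-LIST class
«universal-closure REFUTED / schema; instance form PROVED»).  Classical bookkeeping; nothing here bears on the
disputed [IUTchIII] Cor. 3.12 or takes a side; a refuted closure is a statement about the typing, not about the
paper.
-/

namespace Literature.IUT.LogThetaLattice

variable {k : Type*} [Field k]

/-- For the zero homomorphism `logk = 0` the log-shell `I_k = (p^*)⁻¹ · log_k(O_k^×)` is `{0}`.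
[cite: Mochizuki2012, III Rmk 1.2.2 (i) p.36] -/
theorem nonarchLogShell_zero (O : ValuationSubring k) (p : ℕ) :
    nonarchLogShell O (0 : Additive (↥O)ˣ →+ k) p = {0} := by
  ext a
  simp only [nonarchLogShell, AddMonoidHom.zero_apply, mul_zero, exists_const, Set.mem_setOf_eq,
    Set.mem_singleton_iff]

/-- **F-2612 is a schema**: `IntegersSubsetLogShell O logk p` FAILS at `logk = 0`, for every field `k`, every
valuation subring `O` and every `p` (`1 ∈ O` but `I_k = {0}`). [cite: Mochizuki2012, III Rmk 1.2.2 (i) p.36] -/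
theorem not_integersSubsetLogShell_zero (O : ValuationSubring k) (p : ℕ) :
    ¬ IntegersSubsetLogShell O (0 : Additive (↥O)ˣ →+ k) p := by
  intro h
  have h1 : (1 : k) ∈ nonarchLogShell O (0 : Additive (↥O)ˣ →+ k) p := h.subset O.one_mem
  rw [nonarchLogShell_zero] at h1
  exact one_ne_zero (Set.mem_singleton_iff.mp h1)

/-- At every `(k, O, p)` SOME additive `logk : O^× → k` violates `IntegersSubsetLogShell` (namely `logk = 0`): the
predicate is a genuine hypothesis on `logk`, not a property of the carrier. [cite: Mochizuki2012, III Rmk 1.2.2 (i) p.36] -/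
theorem exists_not_integersSubsetLogShell (O : ValuationSubring k) (p : ℕ) :
    ∃ logk : Additive (↥O)ˣ →+ k, ¬ IntegersSubsetLogShell O logk p :=
  ⟨0, not_integersSubsetLogShell_zero O p⟩

/-- **The universal closure of F-2612 is false** (witness `k = ℚ`, `O = ⊤`, `logk = 0`, `p = 2`); the printed
statement is the instance `integersSubsetLogShell_of_eq_unitLog` at the `p`-adic logarithm, which is proved.
[cite: Mochizuki2012, III Rmk 1.2.2 (i) p.36] -/
theorem not_forall_integersSubsetLogShell :
    ¬ ∀ (k : Type) (_ : Field k) (O : ValuationSubring k) (logk : Additive (↥O)ˣ →+ k) (p : ℕ),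
      IntegersSubsetLogShell O logk p :=
  fun h => not_integersSubsetLogShell_zero (⊤ : ValuationSubring ℚ) 2 (h ℚ inferInstance ⊤ 0 2)

end Literature.IUT.LogThetaLattice
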